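import Literature.AlgebraicGeometry.Resolution.KangarooAtlasCertElimination

/-!
# Kangaroo atlas — the Kawanoue–Matsuki monomial-case invariants `inv_{MON,♥}`, `inv_{MON,♠}` on the walk (computable twin)

Companion of `PointBlowupIFPMonomial` (statement-level typing) in the style of `KangarooAtlasCertElimination`:
exact integer arithmetic on the walk states of `KangarooAtlasCert` (`Poly`, `State`, `step`) and on the transported
elimination algebra of `KangarooAtlasCertElimination` (`EState`, `reading`), with kernel-checked rows (`decide`).

Source: H. Kawanoue, K. Matsuki, *A new strategy for resolution of singularities in the monomial case in positive
characteristic*, Rev. Mat. Iberoam. **34** (2018) 1229–1276 = arXiv:1507.05195 [KM18].  In the monomial case of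
the Idealistic Filtration Program at a closed point `P` (setting 2.1: `h = x^{p^e} + a_1 x^{p^e-1} + ⋯ + a_{p^e}`,
a monomial `M = ∏_{D ∈ E_young} x_D^{m_D}` with `(M, a) ∈ ℛ_P`, `Σ m_D > a`), [KM18] define `μ(ξ_D) = m_D/a`,
`μ(P) = Σ μ(ξ_D) = ord_P(M_usual)`, the invariant `H` (Def. 2: the slope of a well-adapted `h`),
`H(P) = min {ord_P(a_{p^e})/p^e, μ(P)}` (Prop. 1 (2)), `M_tight = ∏ x_D^{H(ξ_D)}` (Def. 3), good/bad points and
divisors (Def. 4: `P` good iff `ord_P(a_{p^e})/p^e ≥ μ(P)`, `D` good iff `ord_{ξ_D}(a_{p^e})/p^e ≥ μ(ξ_D)`),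
`ρ_D`, `w-ρ_D = res-ord_P(x^r g_x)/p^e − ord_P(M_tight)` (Def. 5), `inv_{MON,♥} = H(P) − ord_P(M_tight)`,
`inv_{MON,♠} = lex{A, B}` with `A` the word of the `w-ρ_D` over the bad divisors in increasing order and
`B = ord_P(M_usual) − ord_P(M_tight)` (Def. 6), tightness `inv_{MON,♥} = 0` (Def. 7), the algorithm 5.1 (centre
`V(x, x_D)` if `dim Sing = 1`, the `D` with `H(ξ_D) ≥ 1` maximal, else `P`), the configurations 1–5 (5.2),
standard/esoteric transformations (Def. 8: esoteric iff `A < Ã`), and prove: Prop. 3 (curve blow-up: `inv_{MON,♠}`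
unchanged; point blow-up, standard: strictly decreases), Prop. 6 (shape of `a_{p^e}` when it increases, with the
bounds (♣1) `(w-ρ_{x̃}(P̃) − inv_{MON,♥}(P))·p^e ≤ s < p^e` and (♣2) `≤ p^{e−1}`, "Moh's inequality"), Prop. 7
(eventual decrease).  [cite: KawanoueMatsuki2018, §4–§6]

THIS TREE'S READING (atlas dictionary D9-1…D9-6, DERIVED conventions recorded in the atlas documentation, never cited
as theorems): for the walk state `(F, r)` of `x^q + F(y,z)` (`F` fully cleaned) carrying the transported elimination
algebra `(ℛ)_r` of `KangarooAtlasCertElimination`: `a_{p^e} := F` is well-adapted at `P` and at the generic points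
`ξ_y, ξ_z` simultaneously (no monomial of `F` is a `q`-th power) and `res-ord = ord` (Prop. 1 (3)); the monomial case
holds iff `(ℛ)_r` is weakly monomial (`reading.weakMono`), and then `μ(ξ_{u_i}) = α_i` (`reading.alphaS / S`);
`E_young` = the exceptional curves through the point; point blow-up: the new divisor has `μ = μ(P) − 1` and `F`, `r`
transform by `step`; curve blow-up `V(x,u_i)`: `F ↦ F/u_i^q` (cleaned), `μ(ξ_{u_i}) ↦ μ(ξ_{u_i}) − 1`.
All orders are scaled by an integer `T` with `q ∣ T` (`T = S·q` on `EState`s, `S` the scale of `reading`):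
`dT = T·ord(F)/q`, `muT_i = T·μ(ξ_{u_i})`, `heartT = T·inv_{MON,♥}`, words are lists of naturals (`T·w-ρ_D`), the
zero word is `[]` and `inv_{MON,♠} = 0` is `none`.  Rows (computations, `decide`): the KM6 seeds of the atlas input
families (`q = 2, 4, 8`: esoteric increases with (♣2) attained for `q = 4, 8`), the unique `inv_{MON,♠}`-increase of
the `m = 2` atlas (`bp-p2e2-y9z10`, an off-algorithm point blow-up: algorithm 5.1 prescribes the curve `V(x,y)` there),
a standard point blow-up of the atlas with the strict decrease of Prop. 3 (b), and a curve blow-up with Prop. 3 (a).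
What is NOT here: `σ`, `μ̃`, `τ > 1`, `E_aged`, the invariant `Γ_tight` beyond its definition data, any claim that
an invariant decreases in general.
-/

namespace Literature.AlgebraicGeometry.Resolution.KangarooAtlasCert

namespace IFPMon

/-! ## Words and the order `lex{A,B}` ([KM18] Def. 6 (i)–(iii)) -/

/-- strict order on words: lexicographic, a proper prefix is smaller, the empty word `0 = []` is the minimum.
[cite: KawanoueMatsuki2018, Def. 6 (i)] -/
def wordLT : List ℕ → List ℕ → Bool
  | _, [] => false
  | [], _ :: _ => true
  | a :: u, b :: v => decide (a < b) || (a == b && wordLT u v)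

/-- `lex{A,B} := (min{A,B}, max{A,B})`; the value `0` (when `A = 0` or `B = 0`) is `none`. [cite: KawanoueMatsuki2018, Def. 6 (ii)–(iii)] -/
def lexPair (A : List ℕ) (B : ℕ) : Option (List ℕ × List ℕ) :=
  if A = [] ∨ B = 0 then none else if wordLT A [B] then some (A, [B]) else some ([B], A)

/-- strict lexicographic order on the values `lex{A,B}` (`none = 0` the minimum). [cite: KawanoueMatsuki2018, Def. 6 (ii)] -/
def pairLT : Option (List ℕ × List ℕ) → Option (List ℕ × List ℕ) → Bool
  | _, none => false
  | none, some _ => true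
  | some (a, b), some (c, d) => wordLT a c || (a == c && wordLT b d)

/-- insertion into a sorted list of naturals. [folklore] -/
def insertNat (a : ℕ) : List ℕ → List ℕ
  | [] => [a]
  | b :: l => if a ≤ b then a :: b :: l else b :: insertNat a l

/-- insertion sort (increasing). [folklore] -/
def sortNat (l : List ℕ) : List ℕ := l.foldr insertNat []

/-! ## The datum at a point and the [KM18] numbers, scaled by `T` (`q ∣ T`) -/

/-- the monomial-case datum at a point of the walk: the cleaned `a_{p^e} = F`, which coordinate hyperplanes are
components of `E_young` through the point, the walk's bookkeeping multiplicities `r`, and `T·μ(ξ_{u_i})`.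
[cite: KawanoueMatsuki2018, 2.1 and 4.1] -/
structure KMInput where
  F : Poly
  exc : List Bool
  r : List ℕ
  muT : List ℕ
  deriving Repr, DecidableEq

/-- indices `i` with `{u_i = 0} ∈ E_young` through the point. [cite: KawanoueMatsuki2018, 2.1 condition 2] -/
def young (I : KMInput) : List ℕ := (List.range I.exc.length).filter (fun i => I.exc.getD i false)

/-- `T·μ(P) = T·Σ_D μ(ξ_D) = T·ord_P(M_usual)`. [cite: KawanoueMatsuki2018, 4.1] -/
def muPT (I : KMInput) : ℕ := (young I).foldl (fun a i => a + I.muT.getD i 0) 0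

/-- `T·ord_P(a_{p^e})/p^e`. [cite: KawanoueMatsuki2018, Prop. 1 (2)] -/
def dT (q T : ℕ) (I : KMInput) : ℕ := ord I.F * T / q

/-- in the setting: `ord_P(a_{p^e}) > p^e` ((4.1)) and `Σ m_D > a` (2.1 condition 2). [cite: KawanoueMatsuki2018, 2.1, (4.1)] -/
def inFrame (q T : ℕ) (I : KMInput) : Bool := decide (q < ord I.F) && decide (T < muPT I)

/-- `T·H(P) = min {T·ord_P(a_{p^e})/p^e, T·μ(P)}` (the cleaned `F` is well-adapted, D9-1). [cite: KawanoueMatsuki2018, Prop. 1 (2)] -/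
def HPT (q T : ℕ) (I : KMInput) : ℕ := min (dT q T I) (muPT I)

/-- `P` is a bad point iff `ord_P(a_{p^e})/p^e < μ(P)`. [cite: KawanoueMatsuki2018, Def. 4 (1)] -/
def pointBad (q T : ℕ) (I : KMInput) : Bool := decide (dT q T I < muPT I)

/-- `ord_{ξ_{u_i}}(a_{p^e})` = the least exponent of `u_i` in `F`. [cite: KawanoueMatsuki2018, 4.2 B] -/
def rhat (i : ℕ) (I : KMInput) : ℕ := leastExp i I.F

/-- `T·H(ξ_{u_i}) = min {T·ord_{ξ}(a_{p^e})/p^e, T·μ(ξ)}` (`F` is well-adapted at `ξ_{u_i}`, D9-1). [cite: KawanoueMatsuki2018, Prop. 1 (2)] -/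
def HxiT (q T : ℕ) (I : KMInput) (i : ℕ) : ℕ := min (rhat i I * T / q) (I.muT.getD i 0)

/-- the divisor `{u_i = 0}` is bad iff `ord_{ξ}(a_{p^e})/p^e < μ(ξ)`. [cite: KawanoueMatsuki2018, Def. 4 (2)] -/
def divBad (q T : ℕ) (I : KMInput) (i : ℕ) : Bool := decide (rhat i I * T / q < I.muT.getD i 0)

/-- the bad components of `E_young` through the point, by index. [cite: KawanoueMatsuki2018, Def. 4 (2)] -/
def badYoung (q T : ℕ) (I : KMInput) : List ℕ := (young I).filter (divBad q T I)

/-- `T·ord_P(M_tight) = Σ_D T·H(ξ_D)`. [cite: KawanoueMatsuki2018, Def. 3] -/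
def ordMtT (q T : ℕ) (I : KMInput) : ℕ := (young I).foldl (fun a i => a + HxiT q T I i) 0

/-- `T·inv_{MON,♥}(P) = T·(H(P) − ord_P(M_tight))`. [cite: KawanoueMatsuki2018, Def. 6 (1)] -/
def heartT (q T : ℕ) (I : KMInput) : ℕ := HPT q T I - ordMtT q T I

/-- `T·B = T·(ord_P(M_usual) − ord_P(M_tight))`. [cite: KawanoueMatsuki2018, Def. 6 (2)(ii)] -/
def BT (q T : ℕ) (I : KMInput) : ℕ := muPT I - ordMtT q T I

/-- `res-ord_P(u_i^r g_{u_i}) = ord_P(In_{ξ_{u_i}}(a_{p^e}))`: the least degree among the terms of `u_i`-degree `ord_{ξ}(a_{p^e})`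
(after full cleaning no `q`-th power can be removed, D9-1). [cite: KawanoueMatsuki2018, Def. 5, Prop. 1 (3)] -/
def resord (i : ℕ) (I : KMInput) : ℕ :=
  let m := rhat i I
  match I.F.filter (fun t => t.1.getD i 0 = m) with
  | [] => 0
  | t :: rest => rest.foldl (fun a s => min a (deg s.1)) (deg t.1)

/-- `T·w-ρ_D = T·(res-ord_P(u^r g_u)/p^e − ord_P(M_tight))` for a bad divisor `D = {u_i = 0}`. [cite: KawanoueMatsuki2018, Def. 5] -/
def wrhoT (q T : ℕ) (I : KMInput) (i : ℕ) : ℕ := resord i I * T / q - ordMtT q T I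

/-- the word `A`: the `T·w-ρ_D` of the bad divisors in increasing order; `A = 0 = []` if there is no bad divisor or a letter is `0`.
[cite: KawanoueMatsuki2018, Def. 6 (2)(i)] -/
def Aword (q T : ℕ) (I : KMInput) : List ℕ :=
  let ws := (badYoung q T I).map (wrhoT q T I)
  if ws = [] ∨ ws.any (fun w => w == 0) then [] else sortNat ws

/-- `T·inv_{MON,♠}(P) = lex{A,B}`. [cite: KawanoueMatsuki2018, Def. 6 (2)(iii)] -/
def spade (q T : ℕ) (I : KMInput) : Option (List ℕ × List ℕ) := lexPair (Aword q T I) (BT q T I)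

/-- tight monomial case: `inv_{MON,♥} = 0`. [cite: KawanoueMatsuki2018, Def. 7] -/
def tight (q T : ℕ) (I : KMInput) : Bool := heartT q T I == 0

/-- configuration `1–5` of 5.2 (`0`: no component of `E_young` through the point). [cite: KawanoueMatsuki2018, 5.2] -/
def config (q T : ℕ) (I : KMInput) : ℕ :=
  match (young I).length, (badYoung q T I).length with
  | 0, _ => 0 | 1, 0 => 1 | 2, 0 => 2 | 1, _ => 3 | 2, 1 => 4 | _, _ => 5

/-- the centre of algorithm 5.1: `0` = the point `P` (`dim Sing(ℛ)_P = 0`); `i + 1` = the curve `V(x, u_i)` (`H(ξ_{u_i}) ≥ 1`, the largest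
`H`); `99` = two curves with equal `H` (the rule "bigger index" needs the divisors' ages, not carried here). [cite: KawanoueMatsuki2018, 5.1] -/
def centre (q T : ℕ) (I : KMInput) : ℕ :=
  match (young I).filter (fun i => T ≤ HxiT q T I i) with
  | [] => 0
  | [i] => i + 1
  | i :: j :: _ => if HxiT q T I j < HxiT q T I i then i + 1 else if HxiT q T I i < HxiT q T I j then j + 1 else 99

/-- the [KM18] reading at a point (all orders `× T`). [cite: KawanoueMatsuki2018, §4–§5] -/
structure KMReading where
  inFrame : Bool
  dT : ℕ
  muPT : ℕ
  pointBad : Bool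
  HxiT : List ℕ
  divBad : List Bool
  ordMtT : ℕ
  heartT : ℕ
  BT : ℕ
  A : List ℕ
  spade : Option (List ℕ × List ℕ)
  tight : Bool
  config : ℕ
  centre : ℕ
  deriving Repr, DecidableEq

/-- compute the reading. [cite: KawanoueMatsuki2018, §4–§5] -/
def kmRead (q T : ℕ) (I : KMInput) : KMReading :=
  { inFrame := inFrame q T I, dT := dT q T I, muPT := muPT I, pointBad := pointBad q T I,
    HxiT := (List.range I.exc.length).map (fun i => if I.exc.getD i false then HxiT q T I i else 0),
    divBad := (List.range I.exc.length).map (fun i => I.exc.getD i false && divBad q T I i),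
    ordMtT := ordMtT q T I, heartT := heartT q T I, BT := BT q T I, A := Aword q T I, spade := spade q T I,
    tight := tight q T I, config := config q T I, centre := centre q T I }

/-! ## Transformations (D9-4) -/

/-- point blow-up at `P`, chart `u_j`, other coordinates translated by `b`: `F`, `r` by `step`; the new exceptional divisor `{u_j = 0}`
gets `μ = μ(P) − 1`, a strict transform `{u_i = 0}` (`b_i = 0`) keeps its `μ`. [cite: KawanoueMatsuki2018, 6.2 (0)] -/
def pointChild (p q T : ℕ) (I : KMInput) (j : ℕ) (b : List ℕ) : Option KMInput :=
  match step p q ⟨I.F, I.r⟩ j b with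
  | none => none
  | some s' => some
      { F := s'.F,
        exc := (List.range I.exc.length).map (fun i => decide (i = j) || (I.exc.getD i false && (b.getD i 0 == 0))),
        r := s'.r,
        muT := (List.range I.exc.length).map (fun i => if i = j then muPT I - T else (if b.getD i 0 = 0 then I.muT.getD i 0 else 0)) }

/-- blow-up of the curve `V(x, u_i)` (permissible when `H(ξ_{u_i}) ≥ 1`), read at the unique point above `P`: `F ↦ F/u_i^q` (cleaned),
`μ(ξ_{u_i}) ↦ μ(ξ_{u_i}) − 1`, `r_i ↦ r_i − q`. [cite: KawanoueMatsuki2018, Prop. 3 Case (a)] -/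
def curveChild (q T : ℕ) (I : KMInput) (i : ℕ) : Option KMInput :=
  if I.F.all (fun t => q ≤ t.1.getD i 0) then
    some { F := clean q (I.F.map (fun t => (t.1.set i (t.1.getD i 0 - q), t.2))), exc := I.exc,
           r := I.r.set i (I.r.getD i 0 - q), muT := I.muT.set i (I.muT.getD i 0 - T) }
  else none

/-- the datum of a walk state carrying `(ℛ)_r` (scale `S` of `reading`; `T = S·q`): `E_young` = the exceptional curves (`r_i ≠ 0`),
`μ(ξ_{u_i}) = α_i`. (D9-2/D9-3) [cite: KawanoueMatsuki2018, 2.1 condition 2] -/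
def ofEState (p q S : ℕ) (es : EState) : KMInput :=
  { F := es.s.F, exc := es.s.r.map (fun x => decide (x ≠ 0)), r := es.s.r, muT := (reading p q S es).alphaS.map (fun a => a * q) }

/-! ## Edge predicates -/

/-- esoteric transformation: `A(P) < A(P̃)`. [cite: KawanoueMatsuki2018, Def. 8] -/
def esoteric (q T : ℕ) (I J : KMInput) : Bool := wordLT (Aword q T I) (Aword q T J)

/-- `inv_{MON,♠}(P) < inv_{MON,♠}(P̃)`. [cite: KawanoueMatsuki2018, Def. 6] -/
def increase (q T : ℕ) (I J : KMInput) : Bool := pairLT (spade q T I) (spade q T J)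

/-- `T·(w-ρ_{x̃}(P̃) − inv_{MON,♥}(P))` for `P̃` in configuration 3 (its unique bad divisor `x̃`). [cite: KawanoueMatsuki2018, Prop. 6 (♣1)] -/
def jumpT (q T : ℕ) (I J : KMInput) : ℕ :=
  match badYoung q T J with
  | [i] => wrhoT q T J i - heartT q T I
  | _ => 0

/-- Moh's inequality (♣2): `(w-ρ_{x̃}(P̃) − inv_{MON,♥}(P))·p^e ≤ p^{e−1}`, i.e. `T·jump·p ≤ T`. [cite: KawanoueMatsuki2018, Prop. 6 (♣2)] -/
def club2 (p q T : ℕ) (I J : KMInput) : Bool := decide (jumpT q T I J * p ≤ T)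

/-- (♣1): `(w-ρ_{x̃}(P̃) − inv_{MON,♥}(P))·p^e ≤ s < p^e` with `s = ⌈H(ξ_y)·p^e⌉` for the other divisor `y = u_o` at `P`. [cite: KawanoueMatsuki2018, Prop. 6 (♣1)] -/
def club1 (q T : ℕ) (I J : KMInput) (o : ℕ) : Bool :=
  let s := (HxiT q T I o * q + T - 1) / T
  decide (jumpT q T I J * q ≤ s * T) && decide (s < q)

/-! ## Rows -/

section Rows

/-- KM6 seed of the atlas input family, `q = 2`: `F = yz(y+z)² = y³z + yz³`, both coordinate curves young with
`μ = (2, 3/2)` (`T = 2`): in frame, configuration 5, bad point, `T·inv_♥ = 2`, `A = [2,2]`, `T·B = 5`,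
`T·inv_♠ = lex{[2,2],[5]}`, algorithm 5.1 blows up the point (`centre = 0`).  At the point `z/y = 1` of the
`y`-chart: `F̃ = y²z̃³`, configuration 3, `T·inv_♠ = lex{[3],[3]}` — an INCREASE, esoteric (`[2,2] < [3]`), with
jump `T·(w-ρ_ỹ(P̃) − inv_♥(P)) = 1`, (♣2) `1·p ≤ T` and (♣1) (`s = 1 < 2`) hold; at the origin of the same chart the
new point is tight (`inv_♠ = 0`, a decrease). (computation) [cite: KawanoueMatsuki2018, Def. 6, Def. 8, Prop. 6] -/
def km6q2 : KMInput := ⟨[([3, 1], 1), ([1, 3], 1)], [true, true], [1, 1], [4, 3]⟩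

/-- see `km6q2`. (computation) [cite: KawanoueMatsuki2018, Def. 6, Def. 8, Prop. 6 (♣1), (♣2)] -/
theorem km6q2_jump :
    kmRead 2 2 km6q2 = ⟨true, 4, 7, true, [1, 1], [true, true], 2, 2, 5, [2, 2], some ([2, 2], [5]), false, 5, 0⟩ ∧
    pointChild 2 2 2 km6q2 0 [0, 1] = some ⟨[([2, 3], 1)], [true, false], [2, 0], [5, 0]⟩ ∧
    (pointChild 2 2 2 km6q2 0 [0, 1]).map (kmRead 2 2) =
      some ⟨true, 5, 5, false, [2, 0], [true, false], 2, 3, 3, [3], some ([3], [3]), false, 3, 1⟩ ∧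
    (pointChild 2 2 2 km6q2 0 [0, 1]).map
      (fun J => (esoteric 2 2 km6q2 J, increase 2 2 km6q2 J, jumpT 2 2 km6q2 J, club2 2 2 2 km6q2 J, club1 2 2 km6q2 J 1)) =
      some (true, true, 1, true, true) := by
  decide

/-- see `km6q2`: at the origin of the `y`-chart the transform `F̃ = y²z + y²z³` with `T·μ = (5, 3)` is TIGHT
(`inv_♥ = 0`, `inv_♠ = 0`): a strict decrease of `inv_♠`, and algorithm 5.1 then blows up the curve `V(x,y)`
(`T·H(ξ_y) = 2 ≥ T`). (computation) [cite: KawanoueMatsuki2018, Def. 7, 5.1] -/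
theorem km6q2_origin_tight :
    (pointChild 2 2 2 km6q2 0 [0, 0]).map (kmRead 2 2) =
      some ⟨true, 3, 8, true, [2, 1], [true, true], 3, 0, 5, [], none, true, 5, 1⟩ ∧
    (pointChild 2 2 2 km6q2 0 [0, 0]).map (fun J => increase 2 2 J km6q2) = some true := by
  decide

/-- Prop. 3 Case (a) on the esoteric child of `km6q2`: blowing up the curve `V(x, ỹ)` (`H(ξ_ỹ) = 1`) gives
`F = z̃³`, `T·μ(ξ_ỹ) = 3`, and `T·inv_♠ = lex{[3],[3]}` is UNCHANGED; the next centre is the point.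
(computation) [cite: KawanoueMatsuki2018, Prop. 3 (a)] -/
theorem km6q2_curve_unchanged :
    ((pointChild 2 2 2 km6q2 0 [0, 1]).bind (fun J => curveChild 2 2 J 0)) = some ⟨[([0, 3], 1)], [true, false], [0, 0], [3, 0]⟩ ∧
    ((pointChild 2 2 2 km6q2 0 [0, 1]).bind (fun J => curveChild 2 2 J 0)).map (kmRead 2 2) =
      some ⟨true, 3, 3, false, [0, 0], [true, false], 0, 3, 3, [3], some ([3], [3]), false, 3, 0⟩ ∧
    ((pointChild 2 2 2 km6q2 0 [0, 1]).bind (fun J => (curveChild 2 2 J 0).map (fun K => (increase 2 2 J K, increase 2 2 K J)))) =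
      some (false, false) := by
  decide

/-- KM6 seed, `q = 4` (`p = 2`, `e = 2`): `F = y²z²(y+z)⁴ = y²z⁶ + y⁶z²`, `T·μ = (7, 6)` (`T = 4`): configuration 5,
`T·inv_♠ = lex{[4,4],[9]}`; at `z/y = 1` of the `y`-chart `F̃ = y⁴z̃⁶`, `T·inv_♠ = lex{[5],[6]}` — an esoteric increase with
`T·jump = 2`, i.e. `(w-ρ − inv_♥)·p^e = 2 = p^{e−1}`: Moh's inequality (♣2) is ATTAINED. (computation)
[cite: KawanoueMatsuki2018, Prop. 6 (♣2), Remark 7 (1)] -/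
def km6q4 : KMInput := ⟨[([2, 6], 1), ([6, 2], 1)], [true, true], [2, 2], [7, 6]⟩

/-- see `km6q4`. (computation) [cite: KawanoueMatsuki2018, Prop. 6 (♣2)] -/
theorem km6q4_jump_attains_moh :
    kmRead 4 4 km6q4 = ⟨true, 8, 13, true, [2, 2], [true, true], 4, 4, 9, [4, 4], some ([4, 4], [9]), false, 5, 0⟩ ∧
    pointChild 2 4 4 km6q4 0 [0, 1] = some ⟨[([4, 6], 1)], [true, false], [4, 0], [9, 0]⟩ ∧
    (pointChild 2 4 4 km6q4 0 [0, 1]).map (kmRead 4 4) =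
      some ⟨true, 10, 9, false, [4, 0], [true, false], 4, 5, 5, [6], some ([5], [6]), false, 3, 1⟩ ∧
    (pointChild 2 4 4 km6q4 0 [0, 1]).map
      (fun J => (esoteric 4 4 km6q4 J, increase 4 4 km6q4 J, jumpT 4 4 km6q4 J, club2 2 4 4 km6q4 J, club1 4 4 km6q4 J 1)) =
      some (true, true, 2, true, true) ∧
    jumpT 4 4 km6q4 ⟨[([4, 6], 1)], [true, false], [4, 0], [9, 0]⟩ * 2 = 4 := by
  decide

/-- KM6 seed, `q = 8` (`p = 2`, `e = 3`): `F = y⁴z⁴(y+z)⁸`, `T·μ = (13, 12)` (`T = 8`); at `z/y = 1` of the `y`-chart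
`F̃ = y⁸z̃¹²` and `T·jump = 4`, i.e. `(w-ρ − inv_♥)·p^e = 4 = p^{e−1}`: (♣2) attained again. (computation)
[cite: KawanoueMatsuki2018, Prop. 6 (♣2)] -/
def km6q8 : KMInput := ⟨[([4, 12], 1), ([12, 4], 1)], [true, true], [4, 4], [13, 12]⟩

/-- see `km6q8`. (computation) [cite: KawanoueMatsuki2018, Prop. 6 (♣2)] -/
theorem km6q8_jump_attains_moh :
    kmRead 8 8 km6q8 = ⟨true, 16, 25, true, [4, 4], [true, true], 8, 8, 17, [8, 8], some ([8, 8], [17]), false, 5, 0⟩ ∧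
    (pointChild 2 8 8 km6q8 0 [0, 1]).map (kmRead 8 8) =
      some ⟨true, 20, 17, false, [8, 0], [true, false], 8, 9, 9, [12], some ([9], [12]), false, 3, 1⟩ ∧
    (pointChild 2 8 8 km6q8 0 [0, 1]).map
      (fun J => (esoteric 8 8 km6q8 J, increase 8 8 km6q8 J, jumpT 8 8 km6q8 J, club2 2 8 8 km6q8 J)) =
      some (true, true, 4, true) := by
  decide

/-- THE unique `inv_{MON,♠}`-increase among the 130014 edges of the `m = 2` atlas (census of this layer): item
`bp-p2e2-y9z10` (`x⁴ + y⁹ + z¹⁰`, `p = 2`), node 10 = the walk state after the charts `z, y, y, y` at the origins,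
`F = y¹²z⁵ + y⁶z⁶`, `r = (6,5)`, carrying the transported `(ℛ)_r` of `KangarooAtlasCertElimination.bp_p2e2_y9z10`
(`S = 6`, `α = (14/3, 5/3)`, weakly monomial), `T = 24`: configuration 5, `T·inv_♥ = 6`, `A = [6, 36]`, `T·B = 86`;
algorithm 5.1 would blow up the CURVE `V(x,y)` here (`T·H(ξ_y) = 36 ≥ T`: `centre = 1`) — the atlas blows up the point
(off-algorithm).  Its child at `z/y = 1` (node 14): `F̃ = y¹³(1 + z + z⁴ + z⁵) + y⁸(z² + z⁶)`, `(ℛ)` still weakly monomial with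
`T·μ(ξ_y) = 128`, configuration 3, `T·inv_♠ = lex{[12],[80]} > lex{[6,36],[86]}`: esoteric, `T·jump = 6`, and (♣2) holds
(`6·p ≤ 24`). (computation) [cite: KawanoueMatsuki2018, Def. 6, Def. 8, 5.1, Prop. 6 (♣2)] -/
def bpNode10 : EState := ⟨⟨[([12, 5], 1), ([6, 6], 1)], [6, 5]⟩, [([([14, 5], 1)], 3), ([([12, 6], 1)], 2)]⟩

/-- node 10 of `bp-p2e2-y9z10` is the walk state reached from the root by the charts `z, y, y, y` at the origins.
(computation) [cite: BravoVillamayor2010, §6] -/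
theorem bpNode10_path :
    ((((estep 2 4 (eroot 2 4 [([9, 0], 1), ([0, 10], 1)]) 1 [0, 0]).bind (fun es => estep 2 4 es 0 [0, 0])).bind
      (fun es => estep 2 4 es 0 [0, 0])).bind (fun es => estep 2 4 es 0 [0, 0])) = some bpNode10 := by
  decide

/-- see `bpNode10`. (computation) [cite: KawanoueMatsuki2018, Def. 6, Def. 8, 5.1, Prop. 6 (♣2)] -/
theorem bp_p2e2_y9z10_increase :
    kmRead 4 24 (ofEState 2 4 6 bpNode10) =
      ⟨true, 72, 152, true, [36, 30], [true, true], 66, 6, 86, [6, 36], some ([6, 36], [86]), false, 5, 1⟩ ∧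
    (estep 2 4 bpNode10 0 [0, 1]).map (fun es => (reading 2 4 6 es).weakMono) = some true ∧
    (estep 2 4 bpNode10 0 [0, 1]).map (fun es => kmRead 4 24 (ofEState 2 4 6 es)) =
      some ⟨true, 60, 128, true, [48, 0], [true, false], 48, 12, 80, [12], some ([12], [80]), false, 3, 1⟩ ∧
    (estep 2 4 bpNode10 0 [0, 1]).map (fun es =>
      (esoteric 4 24 (ofEState 2 4 6 bpNode10) (ofEState 2 4 6 es), increase 4 24 (ofEState 2 4 6 bpNode10) (ofEState 2 4 6 es),
       jumpT 4 24 (ofEState 2 4 6 bpNode10) (ofEState 2 4 6 es), club2 2 4 24 (ofEState 2 4 6 bpNode10) (ofEState 2 4 6 es))) =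
      some (true, true, 6, true) := by
  decide

/-- A point blow-up PRESCRIBED by algorithm 5.1 in the atlas, with the strict decrease of Prop. 3 (b): item `bp-p2e1-y3z5`
(`x² + y³ + z⁵`), node 2 = charts `z, y` at the origins: `F = y²z + yz³`, `r = (1,1)`, `S = 1`, `α = (2,1)`, `T = 2`:
configuration 5, `T·H(ξ) = (1,1) < T` so the centre is the point, `T·inv_♠ = lex{[1,2],[4]}`; its child at the origin of
the `z`-chart (node 4): `F̃ = y²z + yz²`, `α = (2,2)`, `T·inv_♠ = lex{[1,1],[6]} < lex{[1,2],[4]}` (standard, decrease).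
(computation) [cite: KawanoueMatsuki2018, 5.1, Prop. 3 (b)] -/
theorem bp_p2e1_y3z5_standard_drop :
    ((estep 2 2 (eroot 2 2 [([3, 0], 1), ([0, 5], 1)]) 1 [0, 0]).bind (fun es => estep 2 2 es 0 [0, 0])).map
      (fun es => (es.s, kmRead 2 2 (ofEState 2 2 1 es))) =
      some (⟨[([2, 1], 1), ([1, 3], 1)], [1, 1]⟩,
        ⟨true, 3, 6, true, [1, 1], [true, true], 2, 1, 4, [1, 2], some ([1, 2], [4]), false, 5, 0⟩) ∧
    (((estep 2 2 (eroot 2 2 [([3, 0], 1), ([0, 5], 1)]) 1 [0, 0]).bind (fun es => estep 2 2 es 0 [0, 0])).bind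
      (fun es => (estep 2 2 es 1 [0, 0]).map (fun es' =>
        (es'.s, kmRead 2 2 (ofEState 2 2 1 es'), esoteric 2 2 (ofEState 2 2 1 es) (ofEState 2 2 1 es'),
         increase 2 2 (ofEState 2 2 1 es') (ofEState 2 2 1 es))))) =
      some (⟨[([2, 1], 1), ([1, 2], 1)], [1, 1]⟩,
        ⟨true, 3, 8, true, [1, 1], [true, true], 2, 1, 6, [1, 1], some ([1, 1], [6]), false, 5, 0⟩, false, true) := by
  decide

/-- the order on words: `0 = []` is the minimum, a proper prefix is smaller, and comparison is lexicographic — on the letters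
met in the rows. (computation) [cite: KawanoueMatsuki2018, Def. 6 (i)–(ii)] -/
theorem wordLT_rows :
    wordLT [] [1] = true ∧ wordLT [1] [] = false ∧ wordLT [2, 2] [3] = true ∧ wordLT [1, 1] [1, 2] = true ∧
    wordLT [6] [6, 36] = true ∧ wordLT [6, 36] [6] = false ∧ pairLT none (some ([1], [1])) = true ∧
    pairLT (some ([6, 36], [86])) (some ([12], [80])) = true ∧ lexPair [6, 36] 86 = some ([6, 36], [86]) ∧
    lexPair [9] 6 = some ([6], [9]) ∧ lexPair [3] 0 = none ∧ lexPair [] 5 = none := by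
  decide

end Rows

end IFPMon

end Literature.AlgebraicGeometry.Resolution.KangarooAtlasCert
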